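import Summits.ValiantsHypothesis.ValiantsHypothesis.Theses.SymmetroidDescartes
import Summits.ValiantsHypothesis.ValiantsHypothesis.Theorems.DerivedPencilRolle.Negative.DerivedPencilRolleUniformStep
import Summits.ValiantsHypothesis.ValiantsHypothesis.Theorems.SymmetroidDescartesRolleToDescartes

/-!
# `DerivedPencilRolle` — negative lemma: the crux is FALSE modulo `TriangularClassManyRoots`

Crux `stmt-ValiantsHypothesis-18500` (`Theses.SymmetroidDescartes.DerivedPencilRolle`), at fixed constants
`PencilBound C a m` (tree): `Z₊(det F) ≤ C · Z₊(det ∂F) + (m+K)^a` for every `(K+1)`-term lacunary pencil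
`F = Σ X^{d l} • S l` with real symmetric invertible `m × m` coefficients and strictly increasing `d`.

## The triangular (ABP) class kills the Rolle term

Let `T 0` be ANY invertible real `k × k` matrix and `T 1, …, T K` UPPER TRIANGULAR with POSITIVE diagonals,
`d 0 = 0 < d 1 < … < d K`, and `P(t) = Σ_l t^{d l} T l` (a "triangular-class" lacunary matrix polynomial).
Symmetrise: `S 0 = [[0, T 0], [(T 0)ᵀ, 1]]`, `S l = [[0, T l], [(T l)ᵀ, 0]]` (`l ≥ 1`), size `m = k + k`.
Then every `S l` is symmetric invertible, `det (Σ t^{d l} S l) = det(−P(t)P(t)ᵀ) = ± det P(t)²`, and the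
derived pencil is `∂F(t) = [[0, P'(t)], [P'(t)ᵀ, 0]]` with `P'(t) = Σ_{l≥1} d_l t^{d_l−1} T l` upper triangular
with positive diagonal for `t > 0` — so `det ∂F(t) ≠ 0` on `(0,∞)` and **`Z₊(det ∂F) = 0`**.  Hence
(`triangular_bound_of_pencilBound`): `PencilBound C a (k+k)` forces the ABSOLUTE polynomial bound
`Z₊(det P) ≤ (k+k+K)^a` on the whole triangular class, whatever `C` is.

The triangular class is universal for algebraic branching programs over lacunary monomials: an ABP on
nodes `0 < 1 < ⋯ < k` with edge labels `c` or `c·t^D` is `det(U(t) − J)` (`J` = subdiagonal ones, `U` upper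
triangular holding the labels; all path products enter with sign `+`), and adding `ε·Σ_l t^{d l}` to the
diagonal (plus a generic constant to `T 0`) puts it in the class while preserving the strict signs of
`det` at any finite set of test points (Disproof.lean §A).  So the crux implies a POLYNOMIAL real-τ bound
for skew circuits over lacunary monomials — far stronger than the `K^{bK}` the route needs.

## `TriangularClassManyRoots` (the hypothesis H, filed for construction)

H says the triangular class has super-polynomially many positive roots: for every `a` some instance has
`Z₊(det P) > (2k+K)^a`.  It is TRUE ON PAPER (Disproof.lean §B, this seat): take a DAG whose parametric
shortest-path cost has `N = n^{Ω(log n)}` linear pieces (Carstensen 1983; Mulmuley–Shah 2001,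
doi:10.1006/jcss.2000.1741; Gajjar–Radhakrishnan, arXiv:1811.05115, Thm 1 — DAGs, integer slopes after
scaling, layered so slopes can be shifted to be non-negative), let `f_A(t) = Σ_paths Π c_e t^{Λ d_e}` be its
positive ABP polynomial (`c_e = e^{Λγ_e}`), `L(s) = max_π (γ_π + s·w_π)` its tropicalisation (`N`
breakpoints `s_r`), and set `f = f_A(t)² − e^{−Λη/2} f_A(e^{η}t) f_A(e^{−η}t)` with `η` below half the
breakpoint spacing: since `L(s+η)+L(s−η)−2L(s)` vanishes off the breakpoints and equals `η·(slope jump) ≥ η`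
at them, for `Λ > 4 log(#paths)/η` the sign of `f(e^s)` is `+` between breakpoints and `−` at each of them:
`2N` alternations, i.e. `Z₊ ≥ 2N = n^{Ω(log n)}` for an ABP of size `O(n)` with `K = O(n²)` exponents, which
beats `(2k+K)^a` for every `a`.  Formalising that family (the recursive Mulmuley–Shah graphs and the
estimate) is the construction item H; it is not small, hence this lemma is filed `--negative-modulo`.

Consequences here (sorry-free): `triangular_bound_of_pencilBound`, `triangularPolyBound_of_derivedPencilRolle`
(the crux ⇒ polynomial bound on the class), `derivedPencilRolle_false_of_triangularClassManyRoots : H → ¬ crux`.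
[folklore] for the linear algebra; the realisation argument is this seat's (Disproof.lean).
-/

-- `Summit.ValiantsHypothesis.ValiantsHypothesis.…` repeats a component by the D-0017 layout
-- (single-conjunct summit), which the `dupNamespace` linter flags; the name is mandated.
set_option linter.dupNamespace false

namespace Summit.ValiantsHypothesis.ValiantsHypothesis.Theorems.DerivedPencilRolle.Negative

open Summit.ValiantsHypothesis.ValiantsHypothesis.Theses.SymmetroidDescartes
open Summit.ValiantsHypothesis.ValiantsHypothesis.Theorems.SymmetroidDescartes (eval_det_pencil
  card_filter_roots_det_sum_fin_zero)
open scoped BigOperators Matrix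
open Polynomial

/-- **H (construction item).** The triangular class — `(K+1)`-term lacunary `k × k` matrix polynomials
`Σ X^{d l} • T l` with `T 0` invertible, `T l` (`l ≥ 1`) upper triangular with positive diagonal, `d 0 = 0`,
`d` strictly increasing — has, for every exponent `a`, a member whose determinant has more than
`(2k+K)^a` distinct positive roots.  (Every ABP over lacunary monomials lies in this class up to a
sign-preserving perturbation; true on paper by parametric-shortest-path breakpoints `n^{Ω(log n)}`
[Carstensen 1983; Mulmuley–Shah 2001; Gajjar–Radhakrishnan arXiv:1811.05115] and the convexity-bump
realisation of `Cruxes/DerivedPencilRolle/Disproof.lean` §B.) [topic Computability/AlgebraicComplexity] -/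
def TriangularClassManyRoots : Prop :=
  ∀ a : ℕ, ∃ (k K : ℕ) (T : Fin (K + 1) → Matrix (Fin k) (Fin k) ℝ) (d : Fin (K + 1) → ℕ),
    d 0 = 0 ∧ StrictMono d ∧ (T 0).det ≠ 0 ∧ (∀ l : Fin K, (T l.succ).BlockTriangular id) ∧
    (∀ (l : Fin K) (i : Fin k), 0 < T l.succ i i) ∧
    (2 * k + K) ^ a <
      ((∑ l, (X : ℝ[X]) ^ d l • (T l).map Polynomial.C).det.roots.toFinset.filter (fun t => 0 < t)).card

/-! ## Linear algebra of the symmetrisation `[[0, T], [Tᵀ, c • 1]]` -/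

section LinearAlgebra

variable {k : ℕ}

/-- `[[0, X], [Xᵀ, 0]]` is invertible when `X` is: `[[0, Xᵀ⁻¹… ]]` — we use the explicit right inverse
`[[0, (Xᵀ)⁻¹], [X⁻¹, 0]]`. -/
theorem det_fromBlocks_zero_transpose_ne_zero (X : Matrix (Fin k) (Fin k) ℝ) (hX : X.det ≠ 0) :
    (Matrix.fromBlocks (0 : Matrix (Fin k) (Fin k) ℝ) X Xᵀ 0).det ≠ 0 := by
  have hX' : IsUnit X.det := isUnit_iff_ne_zero.2 hX
  have hXt : IsUnit Xᵀ.det := by rw [Matrix.det_transpose]; exact hX'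
  have h : Matrix.fromBlocks (0 : Matrix (Fin k) (Fin k) ℝ) X Xᵀ 0 *
      Matrix.fromBlocks (0 : Matrix (Fin k) (Fin k) ℝ) Xᵀ⁻¹ X⁻¹ 0 = 1 := by
    rw [Matrix.fromBlocks_multiply]
    simp [Matrix.mul_nonsing_inv _ hX', Matrix.mul_nonsing_inv _ hXt, Matrix.fromBlocks_one]
  exact (Matrix.isUnit_det_of_right_inverse h).ne_zero

/-- `det [[0, X], [Xᵀ, 1]] = det (−X Xᵀ)`, which vanishes iff `det X = 0`. -/
theorem det_fromBlocks_zero_transpose_one (X : Matrix (Fin k) (Fin k) ℝ) :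
    (Matrix.fromBlocks (0 : Matrix (Fin k) (Fin k) ℝ) X Xᵀ 1).det = (-1) ^ k * X.det ^ 2 := by
  rw [Matrix.det_fromBlocks_one₂₂, zero_sub, Matrix.det_neg, Matrix.det_mul, Matrix.det_transpose,
    Fintype.card_fin]
  ring

/-- The symmetrised block is symmetric. -/
theorem isSymm_fromBlocks_zero_transpose (X : Matrix (Fin k) (Fin k) ℝ) (c : ℝ) :
    (Matrix.fromBlocks (0 : Matrix (Fin k) (Fin k) ℝ) X Xᵀ (c • (1 : Matrix (Fin k) (Fin k) ℝ))).IsSymm := by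
  unfold Matrix.IsSymm
  rw [Matrix.fromBlocks_transpose]
  simp

/-- An upper triangular real matrix with positive diagonal has nonzero (indeed positive) determinant. -/
theorem det_ne_zero_of_upperTriangular_pos (N : Matrix (Fin k) (Fin k) ℝ) (hN : N.BlockTriangular id)
    (hpos : ∀ i, 0 < N i i) : N.det ≠ 0 := by
  rw [Matrix.det_of_upperTriangular hN]
  exact (Finset.prod_pos fun i _ => hpos i).ne'

end LinearAlgebra

/-! ## The symmetrised pencil -/

section Symmetrise

variable {k K : ℕ}

/-- reindexing `Fin k ⊕ Fin k ≃ Fin (k + k)` -/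
def e2 (k : ℕ) : Fin k ⊕ Fin k ≃ Fin (k + k) := finSumFinEquiv

/-- weight of the identity block: `1` on the constant coefficient, `0` on the others -/
def δ (l : Fin (K + 1)) : ℝ := if l = 0 then 1 else 0

/-- the block coefficients: `[[0, T 0], [(T 0)ᵀ, 1]]` and `[[0, T l], [(T l)ᵀ, 0]]` for `l ≥ 1` -/
def blk (T : Fin (K + 1) → Matrix (Fin k) (Fin k) ℝ) (l : Fin (K + 1)) :
    Matrix (Fin k ⊕ Fin k) (Fin k ⊕ Fin k) ℝ :=
  Matrix.fromBlocks 0 (T l) (T l)ᵀ (δ l • (1 : Matrix (Fin k) (Fin k) ℝ))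

/-- the symmetrised coefficients, reindexed to `Fin (k + k)` -/
def symS (T : Fin (K + 1) → Matrix (Fin k) (Fin k) ℝ) (l : Fin (K + 1)) :
    Matrix (Fin (k + k)) (Fin (k + k)) ℝ :=
  Matrix.reindex (e2 k) (e2 k) (blk T l)

/-- the symmetrised coefficients are symmetric -/
theorem symS_isSymm (T : Fin (K + 1) → Matrix (Fin k) (Fin k) ℝ) (l : Fin (K + 1)) :
    (symS T l).IsSymm := by
  unfold symS Matrix.IsSymm
  rw [Matrix.transpose_reindex]
  congr 1
  exact isSymm_fromBlocks_zero_transpose (T l) _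

/-- the symmetrised coefficients are invertible -/
theorem symS_det_ne_zero (T : Fin (K + 1) → Matrix (Fin k) (Fin k) ℝ) (h0 : (T 0).det ≠ 0)
    (htri : ∀ l : Fin K, (T l.succ).BlockTriangular id) (hpos : ∀ (l : Fin K) (i : Fin k), 0 < T l.succ i i)
    (l : Fin (K + 1)) : (symS T l).det ≠ 0 := by
  unfold symS
  rw [Matrix.det_reindex_self]
  unfold blk
  refine Fin.cases ?_ (fun l => ?_) l
  · have h1 : δ (0 : Fin (K + 1)) = 1 := by simp [δ]
    rw [h1, one_smul, det_fromBlocks_zero_transpose_one]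
    exact mul_ne_zero (pow_ne_zero _ (by norm_num)) (pow_ne_zero _ h0)
  · have h1 : δ (Fin.succ l) = 0 := by simp [δ, Fin.succ_ne_zero]
    rw [h1, zero_smul]
    exact det_fromBlocks_zero_transpose_ne_zero _
      (det_ne_zero_of_upperTriangular_pos _ (htri l) (hpos l))

/-- A weighted sum of block matrices is the block matrix of the weighted sums. -/
theorem sum_smul_fromBlocks {ι : Type*} [Fintype ι] (c : ι → ℝ)
    (A B C D : ι → Matrix (Fin k) (Fin k) ℝ) :
    ∑ i, c i • Matrix.fromBlocks (A i) (B i) (C i) (D i) =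
      Matrix.fromBlocks (∑ i, c i • A i) (∑ i, c i • B i) (∑ i, c i • C i) (∑ i, c i • D i) := by
  ext x y
  rcases x with x | x <;> rcases y with y | y <;> simp [Matrix.sum_apply]

/-- A weighted sum of the block coefficients is the block matrix of the weighted sums. -/
theorem sum_smul_blk {ι : Type*} [Fintype ι] (T : Fin (K + 1) → Matrix (Fin k) (Fin k) ℝ)
    (g : ι → Fin (K + 1)) (c : ι → ℝ) :
    ∑ i, c i • blk T (g i) =
      Matrix.fromBlocks 0 (∑ i, c i • T (g i)) (∑ i, c i • T (g i))ᵀ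
        ((∑ i, c i * δ (g i)) • (1 : Matrix (Fin k) (Fin k) ℝ)) := by
  unfold blk
  rw [sum_smul_fromBlocks]
  congr 1
  · simp
  · rw [Matrix.transpose_sum]
    simp [Matrix.transpose_smul]
  · rw [Finset.sum_smul]
    simp [smul_smul]

/-- … and the same after reindexing. -/
theorem sum_smul_symS {ι : Type*} [Fintype ι] (T : Fin (K + 1) → Matrix (Fin k) (Fin k) ℝ)
    (g : ι → Fin (K + 1)) (c : ι → ℝ) :
    ∑ i, c i • symS T (g i) =
      Matrix.reindex (e2 k) (e2 k) (Matrix.fromBlocks 0 (∑ i, c i • T (g i)) (∑ i, c i • T (g i))ᵀ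
        ((∑ i, c i * δ (g i)) • (1 : Matrix (Fin k) (Fin k) ℝ))) := by
  rw [← sum_smul_blk]
  unfold symS
  ext x y
  simp [Matrix.sum_apply]

/-- Evaluating the symmetrised pencil: `det F(t) = (−1)^k · det P(t)²`. -/
theorem eval_det_symS (T : Fin (K + 1) → Matrix (Fin k) (Fin k) ℝ) (d : Fin (K + 1) → ℕ)
    (hd0 : d 0 = 0) (t : ℝ) :
    ((∑ l, (X : ℝ[X]) ^ d l • (symS T l).map Polynomial.C).det).eval t =
      (-1) ^ k * (∑ l, t ^ d l • T l).det ^ 2 := by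
  have hsum := sum_smul_symS T id (fun l => t ^ d l)
  simp only [id] at hsum
  rw [eval_det_pencil, hsum, Matrix.det_reindex_self]
  have hone : (∑ i : Fin (K + 1), t ^ d i * δ i) = 1 := by
    rw [Finset.sum_eq_single (0 : Fin (K + 1))]
    · simp [hd0, δ]
    · intro b _ hb
      simp [hb, δ]
    · simp
  rw [hone, one_smul]
  exact det_fromBlocks_zero_transpose_one (∑ i : Fin (K + 1), t ^ d i • T i)

/-- Evaluating the DERIVED symmetrised pencil at `t > 0` gives a nonzero number (when `K ≥ 1`):
the derived block is `[[0, N], [Nᵀ, 0]]` with `N = Σ_{l≥1} d_l t^{d_l - 1} T l` upper triangular with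
positive diagonal. -/
theorem eval_det_derived_symS_ne_zero (T : Fin (K + 1) → Matrix (Fin k) (Fin k) ℝ)
    (d : Fin (K + 1) → ℕ) (hd : StrictMono d)
    (htri : ∀ l : Fin K, (T l.succ).BlockTriangular id) (hpos : ∀ (l : Fin K) (i : Fin k), 0 < T l.succ i i)
    (hK : 0 < K) (t : ℝ) (ht : 0 < t) :
    ((∑ l : Fin K, (X : ℝ[X]) ^ (d l.succ - d 0 - 1) •
        (((d l.succ - d 0 : ℕ) : ℝ) • symS T l.succ).map Polynomial.C).det).eval t ≠ 0 := by
  have hsmul : ∀ l : Fin K, ((d l.succ - d 0 : ℕ) : ℝ) • symS T l.succ =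
      symS (fun j => ((d j - d 0 : ℕ) : ℝ) • T j) l.succ := by
    intro l
    unfold symS blk
    ext x y
    simp only [Matrix.reindex_apply, Matrix.smul_apply, Matrix.submatrix_apply]
    rcases (e2 k).symm x with x' | x' <;> rcases (e2 k).symm y with y' | y' <;>
      simp [δ, Matrix.fromBlocks_apply₁₁, Matrix.fromBlocks_apply₁₂, Matrix.fromBlocks_apply₂₁,
        Matrix.fromBlocks_apply₂₂, Fin.succ_ne_zero, Matrix.transpose_apply, Matrix.smul_apply]
  simp_rw [hsmul]
  rw [eval_det_pencil, sum_smul_symS _ Fin.succ (fun l : Fin K => t ^ (d l.succ - d 0 - 1)),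
    Matrix.det_reindex_self]
  simp only [δ, Fin.succ_ne_zero, if_false, mul_zero, Finset.sum_const_zero, zero_smul]
  set N : Matrix (Fin k) (Fin k) ℝ :=
    ∑ i : Fin K, t ^ (d i.succ - d 0 - 1) • (((d i.succ - d 0 : ℕ) : ℝ) • T i.succ) with hN
  have hNtri : N.BlockTriangular id := by
    intro i j hij
    simp only [hN, Matrix.sum_apply, Matrix.smul_apply, smul_eq_mul]
    refine Finset.sum_eq_zero fun l _ => ?_
    rw [htri l hij, mul_zero, mul_zero]
  have hNpos : ∀ i, 0 < N i i := by
    intro i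
    simp only [hN, Matrix.sum_apply, Matrix.smul_apply, smul_eq_mul]
    haveI : Nonempty (Fin K) := Fin.pos_iff_nonempty.1 hK
    refine Finset.sum_pos (fun l _ => ?_) Finset.univ_nonempty
    have h1 : 0 < d l.succ - d 0 := Nat.sub_pos_of_lt (hd (Fin.succ_pos l))
    refine mul_pos (pow_pos ht _) (mul_pos ?_ (hpos l i))
    exact_mod_cast h1
  exact det_fromBlocks_zero_transpose_ne_zero N (det_ne_zero_of_upperTriangular_pos N hNtri hNpos)

end Symmetrise

/-! ## The crux bound on the symmetrised pencil is an absolute polynomial bound on the class -/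

/-- **Core.** At fixed constants: `PencilBound C a (k+k)` forces `Z₊(det P) ≤ (k+k+K)^a` for every
member `P = Σ X^{d l} • T l` of the triangular class — the multiplier `C` buys nothing, because the
derived symmetrised pencil has no positive roots at all. -/
theorem triangular_bound_of_pencilBound (C a k K : ℕ) (T : Fin (K + 1) → Matrix (Fin k) (Fin k) ℝ)
    (d : Fin (K + 1) → ℕ) (hd0 : d 0 = 0) (hd : StrictMono d) (h0 : (T 0).det ≠ 0)
    (htri : ∀ l : Fin K, (T l.succ).BlockTriangular id) (hpos : ∀ (l : Fin K) (i : Fin k), 0 < T l.succ i i)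
    (h : PencilBound C a (k + k)) :
    ((∑ l, (X : ℝ[X]) ^ d l • (T l).map Polynomial.C).det.roots.toFinset.filter (fun t => 0 < t)).card ≤
      (k + k + K) ^ a := by
  -- the crux instance at the symmetrised pencil
  have hinst := h K (symS T) d (symS_isSymm T) (symS_det_ne_zero T h0 htri hpos) hd
  -- the derived term vanishes
  have hder : ((∑ l : Fin K, (X : ℝ[X]) ^ (d l.succ - d 0 - 1) •
      (((d l.succ - d 0 : ℕ) : ℝ) • symS T l.succ).map Polynomial.C).det.roots.toFinset.filter
        (fun t => 0 < t)).card = 0 := by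
    rcases Nat.eq_zero_or_pos K with hK | hK
    · subst hK
      exact card_filter_roots_det_sum_fin_zero _ _
    · rw [Finset.card_eq_zero, Finset.filter_eq_empty_iff]
      intro t ht hpos_t
      rw [Multiset.mem_toFinset] at ht
      exact eval_det_derived_symS_ne_zero T d hd htri hpos hK t hpos_t (mem_roots'.1 ht).2
  rw [hder, mul_zero, zero_add] at hinst
  -- the symmetrised determinant has at least the positive roots of `det P`
  refine le_trans (Finset.card_le_card fun t ht => ?_) hinst
  rw [Finset.mem_filter, Multiset.mem_toFinset] at ht ⊢
  obtain ⟨ht, htpos⟩ := ht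
  have hPne := (mem_roots'.1 ht).1
  have hProot := (mem_roots'.1 ht).2
  refine ⟨mem_roots'.2 ⟨?_, ?_⟩, htpos⟩
  · -- `det F ≠ 0`: otherwise `det P` would vanish at every real point
    intro hF
    apply hPne
    refine eq_zero_of_infinite_isRoot _ (Set.infinite_of_forall_exists_gt fun s => ⟨s + 1, ?_, by linarith⟩)
    have hev := congrArg (Polynomial.eval (s + 1)) hF
    rw [eval_det_symS T d hd0, Polynomial.eval_zero] at hev
    have hsq : (∑ l, (s + 1) ^ d l • T l).det = 0 := by
      have := (mul_eq_zero.1 hev).resolve_left (pow_ne_zero _ (by norm_num))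
      exact pow_eq_zero_iff (n := 2) (by norm_num) |>.1 this
    show IsRoot _ _
    rw [IsRoot.def, eval_det_pencil]
    exact hsq
  · rw [IsRoot.def, eval_det_symS T d hd0]
    rw [IsRoot.def, eval_det_pencil] at hProot
    rw [hProot]
    ring

/-- The crux implies an ABSOLUTE polynomial bound on the triangular (ABP) class — a polynomial real-τ
statement for skew circuits over lacunary monomials, in which the Rolle structure plays no role. -/
theorem triangularPolyBound_of_derivedPencilRolle (h : DerivedPencilRolle) :
    ∃ a : ℕ, ∀ (k K : ℕ) (T : Fin (K + 1) → Matrix (Fin k) (Fin k) ℝ) (d : Fin (K + 1) → ℕ),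
      d 0 = 0 → StrictMono d → (T 0).det ≠ 0 → (∀ l : Fin K, (T l.succ).BlockTriangular id) →
      (∀ (l : Fin K) (i : Fin k), 0 < T l.succ i i) →
      ((∑ l, (X : ℝ[X]) ^ d l • (T l).map Polynomial.C).det.roots.toFinset.filter
        (fun t => 0 < t)).card ≤ (2 * k + K) ^ a := by
  obtain ⟨C, a, hCa⟩ := (derivedPencilRolle_iff).1 h
  refine ⟨a, fun k K T d hd0 hd h0 htri hpos => ?_⟩
  have := triangular_bound_of_pencilBound C a k K T d hd0 hd h0 htri hpos (hCa (k + k))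
  rwa [two_mul]

/-- **Negative lemma modulo H.** If the triangular class has super-polynomially many positive roots
(`TriangularClassManyRoots`, true on paper — see the module docstring), the crux `DerivedPencilRolle`
is false. -/
theorem derivedPencilRolle_false_of_triangularClassManyRoots (hH : TriangularClassManyRoots) :
    ¬ DerivedPencilRolle := by
  intro h
  obtain ⟨a, ha⟩ := triangularPolyBound_of_derivedPencilRolle h
  obtain ⟨k, K, T, d, hd0, hd, h0, htri, hpos, hlt⟩ := hH a
  exact absurd (ha k K T d hd0 hd h0 htri hpos) (not_le.2 hlt)

end Summit.ValiantsHypothesis.ValiantsHypothesis.Theorems.DerivedPencilRolle.Negative
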